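/-
Copyright (c) 2026 the pub-hodgecm-mathlib formalisation cell (harness21).  Prover seat hodgecm-mathlib-LH4-p04 (g7), req620 Track A «(D-RAM) FOUR-FRAME» squad
(STAGE-1b, heir LEAD F0P3a-plan (g20∕g21) T19-31∕T19-32 «row T₊ DERIVED»; dealer∕pen LH4-plan (g12∕g13) WORD #48∕#52 «(C2-lev-m_c)»; row-(2) lead LH4-p07 (g8)), 2026-09-04.
-/
import Summits.HodgeConjecture.HodgeConjecture.Theorems.F0P3cDyRamLevelsPieceCountDictionary   -- ★ p858704 (LH4-p06 (g6)): `isLocSmooth_indicator_levels`, `indicator_levels_conj_eq`, `levels_profile_conj_iff`; brings B-p08's ★ generic dictionary file (fixed-coset unfolding, ★ p854712, ★ `LatticeInLevel`)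
import Summits.HodgeConjecture.HodgeConjecture.Theorems.F0P3cDyRamGSideTypeTwoReduction      -- ★ p856218 (LH4-p06 (g3)): the unit piece's (ρ2b) twin; brings ★ p847309 two classes, ★ p846839 compact centraliser, ★ `isRegularElt_of_isLocalNormPair`, ★ `exists_isLocalNormPair_of_formCongr`
import HarnessLib

/-!
# Crux `H413`, line LH4 «(D-RAM) FOUR-FRAME» — STAGE-1b, row (2): brick (C2-lev-dict) «THE TYPE-(2) DICTIONARY OF THE UNLABELLED LEVEL PIECES»
# `Σᶠ_c Δ‴_v(γ_H, out c)·Φ(c, 𝟙_{K_{a,b}}; mG₃) = τ_v(γ_H, μ)·D_v(γ_H)·νG₃(K)·(cnt_{a,b}(ι_w δ₊) − cnt_{a,b}(ι_w δ₋))` on the type-(2) population, law-free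

Cell `hodgecm-mathlib` (D-0151), FLOOR 0, crux item H413 = `stmt-HodgeConjecture-24833`, route of record `HCCMUnconditional`; squad F0∕P3c∕LH4; lane
`--supports stmt-HodgeConjecture-24833 --as helper` (count-neutral; pays NO tier-0 row; the STAGE-1b rows `stub_rows_transvPlus ∕ transvMinus ∕ regular` stay OPEN).
THEOREMS ONLY (no `def`, no instance, no notation, no `sorry`, default heartbeats outside the one statement budget).  Consumer: the chair's DERIVED road for row T₊ and the
D-1b `stub_hside_levLo∕levHi` triples (dealer g13 WORD #52 §3: «row (2) = p07 type-(2) census in X-currency»; organ LH4-p04 (g7) (C2-lev)).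

THE GAP THIS FILE CLOSES.  ROW (2) of a level piece `𝟙_{K_{a,b}} = 𝟙{u ∈ K ∣ X ∈ ϖ^a M₃, X² ∈ ϖ^b M₃}` asks, near `1` on the TYPE-(2) population, for
`Σᶠ_c Δ‴·Φ(c, 𝟙_{K_{a,b}}) = Σ_s coef_s·Φ^st(γ_H, hFamily s)`; LH4-p14 (g6)'s ★ p859279 (V6) reduces it to ONE `G`-side identity in X-currency, whose left side must first be READ
AS A CENSUS.  For the unit piece `1_{K_t}` that reading is ★ p856218 §1 (`Φ(⟦δ⟧, 1_{K_t}) = νG₃(K_t)·#Fix_δ(G_v ⧸ K_t)`, ★ Kottwitz-1988 unfolding) — but the (D-G) dictionary of the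
level pieces, ★ p858704 `pieceCountDictionary_levels`, is typed (through ★ `PieceCountDictionary`) at TYPE-(1) frame literals `ι_w γ = z·Γ_b` ONLY.  B-p08 (g41)'s ★ generic
proof `pieceCountDictionary_of_profile` uses the frame in ONE step — regularity + compact centraliser of `γ` via its eigenframe; steps (2)–(4) (weighted fixed-coset
unfolding ★, separated count ★ p854712, labelled coset ↔ labelled type-0 vertex ★ p854712 with transitivity ★ `exists_unitary_mapGL_eq_of_isSelfDualLattice_ramifiedCM`) are
literal-generic.  HERE:
* §1 `classOrbitalIntegral_profile_eq_mul_ncard_of_isRegularElt` — THE GENERIC PROFILE DICTIONARY AT ONE PLACE FOR ANY REGULAR LITERAL WITH COMPACT CENTRALISER: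
  `Φ(⟦γ⟧, 1_{K ∩ {prof(ι_w u − 1)}}; mG₃) = νG₃(K).toReal · #{M ∣ type-0 vertex, ι_w γ·M = M, Qlat(ι_w γ − 1) M}` (B-p08's text with step (1) turned into the two hypotheses).
* §2 `classOrbitalIntegral_levels_eq_mul_ncard_of_isRegularElt` — the level piece: `Φ(⟦γ⟧, 𝟙_{K_{a,b}}; mG₃) = νG₃(K).toReal · cnt_{a,b}(ι_w γ)` with `cnt_{a,b}` ★ p858704's
  token VERBATIM (`IsVertexLattice σ_w ϖ (antidiag₃) 0 M ∧ ι_w γ·M = M ∧ LatticeInLevel ϖ a (ι_w γ − 1) M ∧ LatticeInLevel ϖ b ((ι_w γ − 1)(ι_w γ − 1)) M`).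
* §3 HEAD `finsum_delta_mul_classOrbitalIntegral_levels_eq_of_typeTwo` — THE κ-ORBITAL INTEGRAL OF `𝟙_{K_{a,b}}` ON A TYPE-(2) `γ_H`, UNFOLDED (★ p856218 §1's twin):
  matches `δ₊, δ₋` of κ-signs `±1` exist and exhaust (★ p847309), each is `G`-regular (★ `isRegularElt_of_isLocalNormPair`) with compact centraliser (★ p846839, type (2) at
  any non-split place), and `Σᶠ_c Δ‴·Φ(c, 𝟙_{K_{a,b}}) = τ·D·νG₃(K)·(cnt_{a,b}(ι_w δ₊) − cnt_{a,b}(ι_w δ₋))` — the two counts are exactly what ★ p859421 ∕ ★ p859229 ∕ ★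
  p859278 ∕ p859305 (order forms) and LH4-p07 (g8)'s (T5-P-axis) evaluate, once `ι_w δ_±` are put in the literal shapes of socket (C″) (the unit road's ★ p857920 frame step).
INSTANCES OF RECORD `(a, b) := (ℓ₀, m_c), (ℓ₀ + 1, m_c)` (free `a b` here).
HONEST LABEL.  Count-neutral, LAW-FREE unfolding over ★ organs; nothing printed is asserted; no census law is stated; `HC_CM` is proved only modulo the 7 printed citations (2
remaining named inputs: hLiu418 = `stmt-HodgeConjecture-24832`, h413 = `stmt-HodgeConjecture-24833`) until rung 0 closes.
## References
* [Kottwitz1988] R. E. Kottwitz, *Tamagawa numbers*, Ann. of Math. 127 (1988): §2 (orbital integrals of indicators as fixed-coset counts).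
* [Kottwitz1986BaseChangeUnits] R. E. Kottwitz, *Base change for unit elements of Hecke algebras*, Compositio Math. 60 (1986): §1 pp. 240–241.
* [Rogawski1990] J. D. Rogawski, *Automorphic Representations of Unitary Groups in Three Variables*, Ann. of Math. Stud. 123 (1990): §4.3 (4.3.1)–(4.3.2) p. 43; §4.9 Prop. 4.9.1 (b) p. 55.
* [Laumon1995] G. Laumon, *Cohomology of Drinfeld Modular Varieties I* (1996): Lemma (5.3.2) p. 136.  [Flicker1998UnitaryFL] Y. Z. Flicker, Canad. J. Math. 50 (1998): Thm. 18 p. 97.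
-/

set_option autoImplicit false

noncomputable section
namespace Summit.HodgeConjecture.HodgeConjecture.Cruxes.H413.F0P3cDyRamLevelsTypeTwoDictionary

open MeasureTheory Measure NumberField IsDedekindDomain Topology Filter
open Literature.NumberTheory.Automorphic Literature.NumberTheory.Automorphic.UnitaryGroup Literature.NumberTheory.Automorphic.IntegralReduction
open Literature.NumberTheory.Automorphic.UnitaryLatticeTree Literature.NumberTheory.Automorphic.HermitianLattice
open Literature.NumberTheory.Rogawski1990 Literature.NumberTheory.GaloisRepresentations
open Literature.MeasureTheory.Group (descConj)
open Literature.NumberTheory.Automorphic.UnitaryThreeFourFrame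
open Summit.HodgeConjecture.HodgeConjecture.Cruxes.H413.F0P3cDyRamFourFramePieces
open Summit.HodgeConjecture.HodgeConjecture.Cruxes.H413.F0P3cDyRamFourFrameCensusDefs
open Summit.HodgeConjecture.HodgeConjecture.Cruxes.H413.F0P3cDyRamProfileLabelTransport
open Summit.HodgeConjecture.HodgeConjecture.Cruxes.H413.F0P3cDyRamProfilePiecesProps
open Summit.HodgeConjecture.HodgeConjecture.Cruxes.H413.F0P3cDyRamAnchorCountDictionaryZero
open Summit.HodgeConjecture.HodgeConjecture.Cruxes.H413.F0P3cDyRamLevelsPieceCountDictionary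
open Summit.HodgeConjecture.HodgeConjecture.Cruxes.H413.F0P3cDyRamFourFrameHSideDefs
open scoped Valued WithZero Matrix MatrixGroups Classical

/-! ## §0 A finsum reading (private, as in B-p08's ★ file) -/

/-- `Σᶠ_{q ∈ s} F q = #{q ∈ s | p q}` for a FINITE `s` when `F = 1` on `p` and `0` off `p` (★ p854712 `finsum_mem_ite_one_zero_eq_ncard_sep`, `if`-free form).
[cite: Laumon1995, Lemma (5.3.2) p. 136] -/
private theorem finsum_mem_eq_ncard_sep_of {α : Type*} (s : Set α) (hs : s.Finite) (F : α → ℂ) (p : α → Prop)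
    (h1 : ∀ q, p q → F q = 1) (h0 : ∀ q, ¬ p q → F q = 0) :
    ∑ᶠ q ∈ s, F q = (({q | q ∈ s ∧ p q} : Set α).ncard : ℂ) := by
  rw [← finsum_mem_ite_one_zero_eq_ncard_sep s hs p]
  refine finsum_mem_congr rfl fun q _ => ?_
  by_cases hq : p q
  · rw [if_pos hq, h1 q hq]
  · rw [if_neg hq, h0 q hq]

/-! ## §1 The generic profile dictionary for ANY regular literal with compact centraliser -/

set_option maxHeartbeats 400000 in
-- budget only: the same statement-heavy tokens as B-p08's ★ `pieceCountDictionary_of_profile` (weighted fixed-coset unfolding over the local unitary group).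
/-- **THE GENERIC PROFILE DICTIONARY AT ONE PLACE, FOR ANY REGULAR LITERAL WITH COMPACT CENTRALISER.**  At a ramified non-split CM place `w ∣ v` with uniformiser `ϖ`: for a
test function `g = 1_{K ∩ {u ∣ prof(ι_w u − 1)}}` (`hg`) that is locally smooth and `K`-supported (`hsm`) and `Ad K`-invariant (`hinv`), a lattice-side reading `Qlat` with the
transport clause `prof(x⁻¹Tx − 1) ↔ Qlat(T − 1)(x·𝒪³)` for unitary `x` (`hprof`), the canonical orbital family `mG₃` of a Haar measure `νG₃`, and ANY `γ ∈ G_v` that is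
`G`-regular with compact centraliser: `Φ(⟦γ⟧, g; mG₃) = νG₃(K).toReal · #{M ∣ IsVertexLattice σ_w ϖ (antidiag₃) 0 M ∧ ι_w γ·M = M ∧ Qlat (ι_w γ − 1) M}`.
(B-p08 (g41)'s ★ `pieceCountDictionary_of_profile`, steps (2)–(5) verbatim; its step (1) — the frame literal's eigenframe — replaced by the two hypotheses.)
[cite: Kottwitz1988, §2] [cite: Kottwitz1986BaseChangeUnits, §1 pp. 240–241] [cite: Rogawski1990, §4.9 Prop. 4.9.1 (b) p. 55] [cite: Laumon1995, Lemma (5.3.2) p. 136] -/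
theorem classOrbitalIntegral_profile_eq_mul_ncard_of_isRegularElt (L : Type) [Field L] [NumberField L] [IsCMField L]
    {v : HeightOneSpectrum (𝓞 ↥(maximalRealSubfield L))} (w : UnitaryGroup.PlacesOver L v)
    (hw : IsCMField.complexConj L • w.1 = w.1) (he : v.asIdeal.ramificationIdx' w.1.asIdeal ≠ 1)
    (ϖ : (w.1.adicCompletion L)) (hϖ : Valued.v ϖ = WithZero.exp (-1 : ℤ))
    [MeasurableSpace ((UnitaryGroup.cmDatum L 3 (Matrix.of fun i j : Fin 3 => if i.val + j.val + 1 = 3 then (1 : L) else 0)).Local v)] [BorelSpace ((UnitaryGroup.cmDatum L 3 (Matrix.of fun i j : Fin 3 => if i.val + j.val + 1 = 3 then (1 : L) else 0)).Local v)]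
    [∀ γ : ((UnitaryGroup.cmDatum L 3 (Matrix.of fun i j : Fin 3 => if i.val + j.val + 1 = 3 then (1 : L) else 0)).Local v), MeasurableSpace (((UnitaryGroup.cmDatum L 3 (Matrix.of fun i j : Fin 3 => if i.val + j.val + 1 = 3 then (1 : L) else 0)).Local v) ⧸ Subgroup.centralizer ({γ} : Set ((UnitaryGroup.cmDatum L 3 (Matrix.of fun i j : Fin 3 => if i.val + j.val + 1 = 3 then (1 : L) else 0)).Local v)))]
    [∀ γ : ((UnitaryGroup.cmDatum L 3 (Matrix.of fun i j : Fin 3 => if i.val + j.val + 1 = 3 then (1 : L) else 0)).Local v), BorelSpace (((UnitaryGroup.cmDatum L 3 (Matrix.of fun i j : Fin 3 => if i.val + j.val + 1 = 3 then (1 : L) else 0)).Local v) ⧸ Subgroup.centralizer ({γ} : Set ((UnitaryGroup.cmDatum L 3 (Matrix.of fun i j : Fin 3 => if i.val + j.val + 1 = 3 then (1 : L) else 0)).Local v)))]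
    (νG₃ : Measure ((UnitaryGroup.cmDatum L 3 (Matrix.of fun i j : Fin 3 => if i.val + j.val + 1 = 3 then (1 : L) else 0)).Local v)) [νG₃.IsHaarMeasure] [νG₃.IsMulRightInvariant]
    (mG₃ : OrbitalMeasureFamily ((UnitaryGroup.cmDatum L 3 (Matrix.of fun i j : Fin 3 => if i.val + j.val + 1 = 3 then (1 : L) else 0)).Local v))
    (hcan : mG₃.IsCanonical (fun γ => IsRegularElt (γ.val : GL (Fin 3) (UnitaryGroup.LocalRing L v))) νG₃)
    (prof : Matrix (Fin 3) (Fin 3) (w.1.adicCompletion L) → Prop)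
    (Qlat : Matrix (Fin 3) (Fin 3) (w.1.adicCompletion L) → Submodule (Valued.integer (w.1.adicCompletion L)) (Fin 3 → w.1.adicCompletion L) → Prop)
    (g : ((UnitaryGroup.cmDatum L 3 (Matrix.of fun i j : Fin 3 => if i.val + j.val + 1 = 3 then (1 : L) else 0)).Local v) → ℂ)
    (hg : g = Set.indicator {u : ((UnitaryGroup.cmDatum L 3 (Matrix.of fun i j : Fin 3 => if i.val + j.val + 1 = 3 then (1 : L) else 0)).Local v) |
      u ∈ (cmLocalIntegralLevel L 3 (Matrix.of fun i j : Fin 3 => if i.val + j.val + 1 = 3 then (1 : L) else 0) v) ∧ prof (wMatrix L w hw u - 1)} (fun _ => (1 : ℂ)))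
    (hsm : IsLocSmooth g ∧ tsupport g ⊆ ((cmLocalIntegralLevel L 3 (Matrix.of fun i j : Fin 3 => if i.val + j.val + 1 = 3 then (1 : L) else 0) v) : Set ((UnitaryGroup.cmDatum L 3 (Matrix.of fun i j : Fin 3 => if i.val + j.val + 1 = 3 then (1 : L) else 0)).Local v)))
    (hinv : ∀ ⦃k : ((UnitaryGroup.cmDatum L 3 (Matrix.of fun i j : Fin 3 => if i.val + j.val + 1 = 3 then (1 : L) else 0)).Local v)⦄, k ∈ (cmLocalIntegralLevel L 3 (Matrix.of fun i j : Fin 3 => if i.val + j.val + 1 = 3 then (1 : L) else 0) v) →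
      ∀ x : ((UnitaryGroup.cmDatum L 3 (Matrix.of fun i j : Fin 3 => if i.val + j.val + 1 = 3 then (1 : L) else 0)).Local v), g (k * x * k⁻¹) = g x)
    (hprof : ∀ (T : Matrix (Fin 3) (Fin 3) (w.1.adicCompletion L)) ⦃x : GL (Fin 3) (w.1.adicCompletion L)⦄,
      x ∈ unitaryGroupOfForm (galAdicCompletionMap (L := L) (IsCMField.complexConj L) hw) ((StdForm.antidiagonal 3).over (w.1.adicCompletion L)) →
        (prof ((x : Matrix (Fin 3) (Fin 3) (w.1.adicCompletion L))⁻¹ * T * (x : Matrix (Fin 3) (Fin 3) (w.1.adicCompletion L)) - 1) ↔ Qlat (T - 1) (mapGL x (stdLattice (w.1.adicCompletion L) 3))))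
    (γ : ((UnitaryGroup.cmDatum L 3 (Matrix.of fun i j : Fin 3 => if i.val + j.val + 1 = 3 then (1 : L) else 0)).Local v))
    (hreg : IsRegularElt (γ.val : GL (Fin 3) (UnitaryGroup.LocalRing L v)))
    [CompactSpace (Subgroup.centralizer ({γ} : Set ((UnitaryGroup.cmDatum L 3 (Matrix.of fun i j : Fin 3 => if i.val + j.val + 1 = 3 then (1 : L) else 0)).Local v)))] :
    classOrbitalIntegral mG₃ g (ConjClasses.mk γ) =
      ((νG₃ (cmLocalIntegralLevel L 3 (Matrix.of fun i j : Fin 3 => if i.val + j.val + 1 = 3 then (1 : L) else 0) v : Set ((UnitaryGroup.cmDatum L 3 (Matrix.of fun i j : Fin 3 => if i.val + j.val + 1 = 3 then (1 : L) else 0)).Local v))).toReal : ℂ) *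
        ({M : Submodule (Valued.integer (w.1.adicCompletion L)) (Fin 3 → w.1.adicCompletion L) |
            IsVertexLattice (galAdicCompletionMap (L := L) (IsCMField.complexConj L) hw) ϖ ((StdForm.antidiagonal 3).over (w.1.adicCompletion L)) 0 M ∧
              mapGL ((localNonsplitEquiv (IsCMField.complexConj L) (Matrix.of fun i j : Fin 3 => if i.val + j.val + 1 = 3 then (1 : L) else 0) (IsCMField.complexConj_ne_one L) w hw γ :
                ↥(unitaryGroupOfForm (galAdicCompletionMap (L := L) (IsCMField.complexConj L) hw) (placeForm (Matrix.of fun i j : Fin 3 => if i.val + j.val + 1 = 3 then (1 : L) else 0) w.1))) : GL (Fin 3) (w.1.adicCompletion L)) M = M ∧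
              Qlat ((((localNonsplitEquiv (IsCMField.complexConj L) (Matrix.of fun i j : Fin 3 => if i.val + j.val + 1 = 3 then (1 : L) else 0) (IsCMField.complexConj_ne_one L) w hw γ :
                ↥(unitaryGroupOfForm (galAdicCompletionMap (L := L) (IsCMField.complexConj L) hw) (placeForm (Matrix.of fun i j : Fin 3 => if i.val + j.val + 1 = 3 then (1 : L) else 0) w.1))) : GL (Fin 3) (w.1.adicCompletion L)) : Matrix (Fin 3) (Fin 3) (w.1.adicCompletion L)) - 1) M}.ncard : ℂ) := by
  have hc1 : IsCMField.complexConj L ≠ 1 := IsCMField.complexConj_ne_one L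
  have hpf : placeForm (Matrix.of fun i j : Fin 3 => if i.val + j.val + 1 = 3 then (1 : L) else 0) w.1 = (StdForm.antidiagonal 3).over (w.1.adicCompletion L) := placeForm_antidiagThree_eq_over L w
  have hH : (((Matrix.of fun i j : Fin 3 => if i.val + j.val + 1 = 3 then (1 : L) else 0)).map (cmConjRingHom L))ᵀ = (Matrix.of fun i j : Fin 3 => if i.val + j.val + 1 = 3 then (1 : L) else 0) := antidiagOne_isHermitian L 3
  have hdet : ((Matrix.of fun i j : Fin 3 => if i.val + j.val + 1 = 3 then (1 : L) else 0)).det ≠ 0 := (isUnit_antidiagOne_det L 3).ne_zero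
  obtain ⟨hKc, hKo⟩ := isCompact_isOpen_cmLocalIntegralLevel L 3 (Matrix.of fun i j : Fin 3 => if i.val + j.val + 1 = 3 then (1 : L) else 0) v
  have hO := isClosed_conjClass_local_of_isRegularElt L 3 (Matrix.of fun i j : Fin 3 => if i.val + j.val + 1 = 3 then (1 : L) else 0) v hH hdet γ hreg
  -- (2) the weighted fixed-coset unfolding on `K`
  obtain ⟨hsm', hts'⟩ := hsm
  rw [classOrbitalIntegral_eq_sum_fixedBy_of_support_subset_of_conj_invariant
    (P := fun γ : ((UnitaryGroup.cmDatum L 3 (Matrix.of fun i j : Fin 3 => if i.val + j.val + 1 = 3 then (1 : L) else 0)).Local v) => IsRegularElt (γ.val : GL (Fin 3) (UnitaryGroup.LocalRing L v)))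
    (fun g' x hg' => isRegularElt_val_conj L 3 (Matrix.of fun i j : Fin 3 => if i.val + j.val + 1 = 3 then (1 : L) else 0) v g' x hg') hcan hreg (cmLocalIntegralLevel L 3 (Matrix.of fun i j : Fin 3 => if i.val + j.val + 1 = 3 then (1 : L) else 0) v) hKo hKc hO g hsm'.continuous
    ((subset_tsupport _).trans hts') (fun k hk x => hinv hk x)]
  -- (3) the summand is `1` iff `out q⁻¹ γ out q ∈ K ∧ prof (ι(out q⁻¹ γ out q) − 1)`: the sum is a separated count of fixed cosets
  have hfin : (MulAction.fixedBy (((UnitaryGroup.cmDatum L 3 (Matrix.of fun i j : Fin 3 => if i.val + j.val + 1 = 3 then (1 : L) else 0)).Local v) ⧸ (cmLocalIntegralLevel L 3 (Matrix.of fun i j : Fin 3 => if i.val + j.val + 1 = 3 then (1 : L) else 0) v)) γ).Finite := finite_fixedBy_quotient_of_isClosed γ (cmLocalIntegralLevel L 3 (Matrix.of fun i j : Fin 3 => if i.val + j.val + 1 = 3 then (1 : L) else 0) v) hO hKo hKc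
  rw [finsum_mem_eq_ncard_sep_of _ hfin (fun q : ((UnitaryGroup.cmDatum L 3 (Matrix.of fun i j : Fin 3 => if i.val + j.val + 1 = 3 then (1 : L) else 0)).Local v) ⧸ (cmLocalIntegralLevel L 3 (Matrix.of fun i j : Fin 3 => if i.val + j.val + 1 = 3 then (1 : L) else 0) v) => g (q.out⁻¹ * γ * q.out))
    (fun q : ((UnitaryGroup.cmDatum L 3 (Matrix.of fun i j : Fin 3 => if i.val + j.val + 1 = 3 then (1 : L) else 0)).Local v) ⧸ (cmLocalIntegralLevel L 3 (Matrix.of fun i j : Fin 3 => if i.val + j.val + 1 = 3 then (1 : L) else 0) v) => q.out⁻¹ * γ * q.out ∈ (cmLocalIntegralLevel L 3 (Matrix.of fun i j : Fin 3 => if i.val + j.val + 1 = 3 then (1 : L) else 0) v) ∧ prof (wMatrix L w hw (q.out⁻¹ * γ * q.out) - 1))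
    (fun q hq => by
      show g (q.out⁻¹ * γ * q.out) = 1
      rw [hg]
      exact Set.indicator_of_mem (s := {u : ((UnitaryGroup.cmDatum L 3 (Matrix.of fun i j : Fin 3 => if i.val + j.val + 1 = 3 then (1 : L) else 0)).Local v) | u ∈ (cmLocalIntegralLevel L 3 (Matrix.of fun i j : Fin 3 => if i.val + j.val + 1 = 3 then (1 : L) else 0) v) ∧ prof (wMatrix L w hw u - 1)}) hq _)
    (fun q hq => by
      show g (q.out⁻¹ * γ * q.out) = 0
      rw [hg]
      exact Set.indicator_of_notMem (s := {u : ((UnitaryGroup.cmDatum L 3 (Matrix.of fun i j : Fin 3 => if i.val + j.val + 1 = 3 then (1 : L) else 0)).Local v) | u ∈ (cmLocalIntegralLevel L 3 (Matrix.of fun i j : Fin 3 => if i.val + j.val + 1 = 3 then (1 : L) else 0) v) ∧ prof (wMatrix L w hw u - 1)}) hq _)]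
  -- (4) the labelled coset count = the labelled fixed-vertex count
  let ι : ((UnitaryGroup.cmDatum L 3 (Matrix.of fun i j : Fin 3 => if i.val + j.val + 1 = 3 then (1 : L) else 0)).Local v) →* GL (Fin 3) (w.1.adicCompletion L) :=
    (Subgroup.subtype _).comp (localNonsplitEquiv (IsCMField.complexConj L) (Matrix.of fun i j : Fin 3 => if i.val + j.val + 1 = 3 then (1 : L) else 0) hc1 w hw).toMulEquiv.toMonoidHom
  have hιe : ∀ u, ι u = ((localNonsplitEquiv (IsCMField.complexConj L) (Matrix.of fun i j : Fin 3 => if i.val + j.val + 1 = 3 then (1 : L) else 0) (IsCMField.complexConj_ne_one L) w hw u :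
        ↥(unitaryGroupOfForm (galAdicCompletionMap (L := L) (IsCMField.complexConj L) hw) (placeForm (Matrix.of fun i j : Fin 3 => if i.val + j.val + 1 = 3 then (1 : L) else 0) w.1))) : GL (Fin 3) (w.1.adicCompletion L)) := fun _ => rfl
  have hN : IsVertexLattice (galAdicCompletionMap (L := L) (IsCMField.complexConj L) hw) ϖ ((StdForm.antidiagonal 3).over (w.1.adicCompletion L)) 0 (stdLattice (w.1.adicCompletion L) 3) :=
    isSelfDualLattice_stdLattice_three_of_v hϖ
  have hKt : ∀ u : ((UnitaryGroup.cmDatum L 3 (Matrix.of fun i j : Fin 3 => if i.val + j.val + 1 = 3 then (1 : L) else 0)).Local v), u ∈ (cmLocalIntegralLevel L 3 (Matrix.of fun i j : Fin 3 => if i.val + j.val + 1 = 3 then (1 : L) else 0) v) ↔ mapGL (ι u) (stdLattice (w.1.adicCompletion L) 3) = stdLattice (w.1.adicCompletion L) 3 := fun u => by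
    rw [hιe]
    exact (mem_localIntegralLevel_iff_of_smul_eq (IsCMField.complexConj L) 3 (Matrix.of fun i j : Fin 3 => if i.val + j.val + 1 = 3 then (1 : L) else 0) hc1 w hw u).trans (mapGL_stdLattice_eq_iff_mem_glInt _).symm
  have hxU : ∀ u : ((UnitaryGroup.cmDatum L 3 (Matrix.of fun i j : Fin 3 => if i.val + j.val + 1 = 3 then (1 : L) else 0)).Local v), ι u ∈ unitaryGroupOfForm (galAdicCompletionMap (L := L) (IsCMField.complexConj L) hw) ((StdForm.antidiagonal 3).over (w.1.adicCompletion L)) := fun u => by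
    rw [hιe]; exact coe_mem_unitaryGroupOfForm_over L w hw u
  have htype : ∀ u : ((UnitaryGroup.cmDatum L 3 (Matrix.of fun i j : Fin 3 => if i.val + j.val + 1 = 3 then (1 : L) else 0)).Local v), IsVertexLattice (galAdicCompletionMap (L := L) (IsCMField.complexConj L) hw) ϖ ((StdForm.antidiagonal 3).over (w.1.adicCompletion L)) 0 (mapGL (ι u) (stdLattice (w.1.adicCompletion L) 3)) :=
    fun u => isVertexLattice_mapGL (galAdicCompletionMap (L := L) (IsCMField.complexConj L) hw) ϖ _ (ι u) (hxU u) hN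
  have htr : ∀ M : Submodule 𝒪[w.1.adicCompletion L] (Fin 3 → w.1.adicCompletion L),
      IsVertexLattice (galAdicCompletionMap (L := L) (IsCMField.complexConj L) hw) ϖ ((StdForm.antidiagonal 3).over (w.1.adicCompletion L)) 0 M → ∃ u : ((UnitaryGroup.cmDatum L 3 (Matrix.of fun i j : Fin 3 => if i.val + j.val + 1 = 3 then (1 : L) else 0)).Local v), mapGL (ι u) (stdLattice (w.1.adicCompletion L) 3) = M := by
    intro M hM
    obtain ⟨u₁, hu₁⟩ := exists_unitary_mapGL_eq_of_isSelfDualLattice_ramifiedCM L v w hw he hϖ hN hM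
    have hu₁' : (u₁ : GL (Fin 3) (w.1.adicCompletion L)) ∈ unitaryGroupOfForm (galAdicCompletionMap (L := L) (IsCMField.complexConj L) hw) (placeForm (Matrix.of fun i j : Fin 3 => if i.val + j.val + 1 = 3 then (1 : L) else 0) w.1) := by
      rw [hpf]; exact u₁.2
    refine ⟨(localNonsplitEquiv (IsCMField.complexConj L) (Matrix.of fun i j : Fin 3 => if i.val + j.val + 1 = 3 then (1 : L) else 0) hc1 w hw).symm ⟨(u₁ : GL (Fin 3) (w.1.adicCompletion L)), hu₁'⟩, ?_⟩
    rw [hιe, ContinuousMulEquiv.apply_symm_apply]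
    exact hu₁
  have hPQ : ∀ x : ((UnitaryGroup.cmDatum L 3 (Matrix.of fun i j : Fin 3 => if i.val + j.val + 1 = 3 then (1 : L) else 0)).Local v), mapGL (ι γ) (mapGL (ι x) (stdLattice (w.1.adicCompletion L) 3)) = mapGL (ι x) (stdLattice (w.1.adicCompletion L) 3) →
      ((x⁻¹ * γ * x ∈ (cmLocalIntegralLevel L 3 (Matrix.of fun i j : Fin 3 => if i.val + j.val + 1 = 3 then (1 : L) else 0) v) ∧ prof (wMatrix L w hw (x⁻¹ * γ * x) - 1)) ↔
        Qlat (((ι γ : GL (Fin 3) (w.1.adicCompletion L)) : Matrix (Fin 3) (Fin 3) (w.1.adicCompletion L)) - 1)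
          (mapGL (ι x) (stdLattice (w.1.adicCompletion L) 3))) := by
    intro x hfix
    have hmemK : x⁻¹ * γ * x ∈ (cmLocalIntegralLevel L 3 (Matrix.of fun i j : Fin 3 => if i.val + j.val + 1 = 3 then (1 : L) else 0) v) := by
      rw [hKt, map_mul, map_mul, map_inv, mapGL_mul, mapGL_mul, hfix, mapGL_inv_mapGL]
    have hconj : wMatrix L w hw (x⁻¹ * γ * x) =
        ((ι x : GL (Fin 3) (w.1.adicCompletion L)) : Matrix (Fin 3) (Fin 3) (w.1.adicCompletion L))⁻¹ *
          ((ι γ : GL (Fin 3) (w.1.adicCompletion L)) : Matrix (Fin 3) (Fin 3) (w.1.adicCompletion L)) *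
            ((ι x : GL (Fin 3) (w.1.adicCompletion L)) : Matrix (Fin 3) (Fin 3) (w.1.adicCompletion L)) := by
      show ((ι (x⁻¹ * γ * x) : GL (Fin 3) (w.1.adicCompletion L)) : Matrix (Fin 3) (Fin 3) (w.1.adicCompletion L)) = _
      rw [map_mul, map_mul, map_inv, Units.val_mul, Units.val_mul, Matrix.coe_units_inv]
    rw [hconj, hprof _ (hxU x)]
    exact ⟨fun h => h.2, fun h => ⟨hmemK, h⟩⟩
  rw [ncard_fixedBy_quotient_sep_eq_ncard_isVertexLattice_fixed_sep ι (stdLattice (w.1.adicCompletion L) 3) (cmLocalIntegralLevel L 3 (Matrix.of fun i j : Fin 3 => if i.val + j.val + 1 = 3 then (1 : L) else 0) v) (galAdicCompletionMap (L := L) (IsCMField.complexConj L) hw) ϖ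
      ((StdForm.antidiagonal 3).over (w.1.adicCompletion L)) 0 hKt htype htr γ
      (fun u : ((UnitaryGroup.cmDatum L 3 (Matrix.of fun i j : Fin 3 => if i.val + j.val + 1 = 3 then (1 : L) else 0)).Local v) => u ∈ (cmLocalIntegralLevel L 3 (Matrix.of fun i j : Fin 3 => if i.val + j.val + 1 = 3 then (1 : L) else 0) v) ∧ prof (wMatrix L w hw u - 1))
      (fun M => Qlat (((ι γ : GL (Fin 3) (w.1.adicCompletion L)) : Matrix (Fin 3) (Fin 3) (w.1.adicCompletion L)) - 1) M) hPQ,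
    Measure.real, Complex.real_smul]
  -- (5) `ι γ` is `ι_w γ` (`rfl`)
  rfl

/-! ## §2 The level piece `𝟙_{K_{a,b}}` at any regular literal with compact centraliser -/

/-- **THE (D-G) DICTIONARY OF `𝟙_{K_{a,b}}` AT ANY REGULAR LITERAL WITH COMPACT CENTRALISER** (so at the type-(2) norm pairs, §3):
`Φ(⟦γ⟧, 𝟙_{K_{a,b}}; mG₃) = νG₃(K).toReal · cnt_{a,b}(ι_w γ)`, `cnt_{a,b}` = ★ p858704's `pieceCountDictionary_levels` census token VERBATIM — §1 at the levels profile with ★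
p858704's smoothness ∕ `Ad K`-invariance ∕ transport clause (`isLocSmooth_indicator_levels`, `indicator_levels_conj_eq`, `levels_profile_conj_iff`).
[cite: Kottwitz1988, §2] [cite: Kottwitz1986BaseChangeUnits, §1 pp. 240–241] [cite: Rogawski1990, §4.9 Prop. 4.9.1 (b) p. 55] -/
theorem classOrbitalIntegral_levels_eq_mul_ncard_of_isRegularElt (L : Type) [Field L] [NumberField L] [IsCMField L]
    {v : HeightOneSpectrum (𝓞 ↥(maximalRealSubfield L))} (w : UnitaryGroup.PlacesOver L v)
    (hw : IsCMField.complexConj L • w.1 = w.1) (he : v.asIdeal.ramificationIdx' w.1.asIdeal ≠ 1)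
    (ϖ : (w.1.adicCompletion L)) (hϖ : Valued.v ϖ = WithZero.exp (-1 : ℤ))
    [MeasurableSpace ((UnitaryGroup.cmDatum L 3 (Matrix.of fun i j : Fin 3 => if i.val + j.val + 1 = 3 then (1 : L) else 0)).Local v)] [BorelSpace ((UnitaryGroup.cmDatum L 3 (Matrix.of fun i j : Fin 3 => if i.val + j.val + 1 = 3 then (1 : L) else 0)).Local v)]
    [∀ γ : ((UnitaryGroup.cmDatum L 3 (Matrix.of fun i j : Fin 3 => if i.val + j.val + 1 = 3 then (1 : L) else 0)).Local v), MeasurableSpace (((UnitaryGroup.cmDatum L 3 (Matrix.of fun i j : Fin 3 => if i.val + j.val + 1 = 3 then (1 : L) else 0)).Local v) ⧸ Subgroup.centralizer ({γ} : Set ((UnitaryGroup.cmDatum L 3 (Matrix.of fun i j : Fin 3 => if i.val + j.val + 1 = 3 then (1 : L) else 0)).Local v)))]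
    [∀ γ : ((UnitaryGroup.cmDatum L 3 (Matrix.of fun i j : Fin 3 => if i.val + j.val + 1 = 3 then (1 : L) else 0)).Local v), BorelSpace (((UnitaryGroup.cmDatum L 3 (Matrix.of fun i j : Fin 3 => if i.val + j.val + 1 = 3 then (1 : L) else 0)).Local v) ⧸ Subgroup.centralizer ({γ} : Set ((UnitaryGroup.cmDatum L 3 (Matrix.of fun i j : Fin 3 => if i.val + j.val + 1 = 3 then (1 : L) else 0)).Local v)))]
    (νG₃ : Measure ((UnitaryGroup.cmDatum L 3 (Matrix.of fun i j : Fin 3 => if i.val + j.val + 1 = 3 then (1 : L) else 0)).Local v)) [νG₃.IsHaarMeasure] [νG₃.IsMulRightInvariant]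
    (mG₃ : OrbitalMeasureFamily ((UnitaryGroup.cmDatum L 3 (Matrix.of fun i j : Fin 3 => if i.val + j.val + 1 = 3 then (1 : L) else 0)).Local v))
    (hcan : mG₃.IsCanonical (fun γ => IsRegularElt (γ.val : GL (Fin 3) (UnitaryGroup.LocalRing L v))) νG₃) (a b : ℕ)
    (γ : ((UnitaryGroup.cmDatum L 3 (Matrix.of fun i j : Fin 3 => if i.val + j.val + 1 = 3 then (1 : L) else 0)).Local v))
    (hreg : IsRegularElt (γ.val : GL (Fin 3) (UnitaryGroup.LocalRing L v)))
    [CompactSpace (Subgroup.centralizer ({γ} : Set ((UnitaryGroup.cmDatum L 3 (Matrix.of fun i j : Fin 3 => if i.val + j.val + 1 = 3 then (1 : L) else 0)).Local v)))] :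
    classOrbitalIntegral mG₃ (Set.indicator {u : ((UnitaryGroup.cmDatum L 3 (Matrix.of fun i j : Fin 3 => if i.val + j.val + 1 = 3 then (1 : L) else 0)).Local v) |
        u ∈ cmLocalIntegralLevel L 3 (Matrix.of fun i j : Fin 3 => if i.val + j.val + 1 = 3 then (1 : L) else 0) v ∧
        (InLevel ϖ a (wMatrix L w hw u - 1) ∧ InLevel ϖ b ((wMatrix L w hw u - 1) * (wMatrix L w hw u - 1)))} (fun _ => (1 : ℂ))) (ConjClasses.mk γ) =
      ((νG₃ (cmLocalIntegralLevel L 3 (Matrix.of fun i j : Fin 3 => if i.val + j.val + 1 = 3 then (1 : L) else 0) v : Set ((UnitaryGroup.cmDatum L 3 (Matrix.of fun i j : Fin 3 => if i.val + j.val + 1 = 3 then (1 : L) else 0)).Local v))).toReal : ℂ) *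
        ({M : Submodule (Valued.integer (w.1.adicCompletion L)) (Fin 3 → w.1.adicCompletion L) |
            IsVertexLattice (galAdicCompletionMap (L := L) (IsCMField.complexConj L) hw) ϖ ((StdForm.antidiagonal 3).over (w.1.adicCompletion L)) 0 M ∧
              mapGL ((localNonsplitEquiv (IsCMField.complexConj L) (Matrix.of fun i j : Fin 3 => if i.val + j.val + 1 = 3 then (1 : L) else 0) (IsCMField.complexConj_ne_one L) w hw γ :
                ↥(unitaryGroupOfForm (galAdicCompletionMap (L := L) (IsCMField.complexConj L) hw) (placeForm (Matrix.of fun i j : Fin 3 => if i.val + j.val + 1 = 3 then (1 : L) else 0) w.1))) : GL (Fin 3) (w.1.adicCompletion L)) M = M ∧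
              (LatticeInLevel ϖ a ((((localNonsplitEquiv (IsCMField.complexConj L) (Matrix.of fun i j : Fin 3 => if i.val + j.val + 1 = 3 then (1 : L) else 0) (IsCMField.complexConj_ne_one L) w hw γ :
                ↥(unitaryGroupOfForm (galAdicCompletionMap (L := L) (IsCMField.complexConj L) hw) (placeForm (Matrix.of fun i j : Fin 3 => if i.val + j.val + 1 = 3 then (1 : L) else 0) w.1))) : GL (Fin 3) (w.1.adicCompletion L)) : Matrix (Fin 3) (Fin 3) (w.1.adicCompletion L)) - 1) M ∧
                LatticeInLevel ϖ b (((((localNonsplitEquiv (IsCMField.complexConj L) (Matrix.of fun i j : Fin 3 => if i.val + j.val + 1 = 3 then (1 : L) else 0) (IsCMField.complexConj_ne_one L) w hw γ :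
                  ↥(unitaryGroupOfForm (galAdicCompletionMap (L := L) (IsCMField.complexConj L) hw) (placeForm (Matrix.of fun i j : Fin 3 => if i.val + j.val + 1 = 3 then (1 : L) else 0) w.1))) : GL (Fin 3) (w.1.adicCompletion L)) : Matrix (Fin 3) (Fin 3) (w.1.adicCompletion L)) - 1) *
                  ((((localNonsplitEquiv (IsCMField.complexConj L) (Matrix.of fun i j : Fin 3 => if i.val + j.val + 1 = 3 then (1 : L) else 0) (IsCMField.complexConj_ne_one L) w hw γ :
                  ↥(unitaryGroupOfForm (galAdicCompletionMap (L := L) (IsCMField.complexConj L) hw) (placeForm (Matrix.of fun i j : Fin 3 => if i.val + j.val + 1 = 3 then (1 : L) else 0) w.1))) : GL (Fin 3) (w.1.adicCompletion L)) : Matrix (Fin 3) (Fin 3) (w.1.adicCompletion L)) - 1)) M)}.ncard : ℂ) := by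
  have hϖ0 : ϖ ≠ 0 := (uniformizer_facts L w hϖ).1
  exact classOrbitalIntegral_profile_eq_mul_ncard_of_isRegularElt L w hw he ϖ hϖ νG₃ mG₃ hcan
    (fun X => InLevel ϖ a X ∧ InLevel ϖ b (X * X)) (fun X M => LatticeInLevel ϖ a X M ∧ LatticeInLevel ϖ b (X * X) M) _ rfl
    (isLocSmooth_indicator_levels L w hw hϖ a b) (fun k hk x => indicator_levels_conj_eq L w hw hϖ a b hk x)
    (fun T x _ => levels_profile_conj_iff hϖ0 a b T x) γ hreg

/-! ## §3 HEAD — the κ-orbital integral of `𝟙_{K_{a,b}}` on a type-(2) `γ_H`, unfolded into the two level censuses -/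

set_option maxHeartbeats 400000 in
/-- **(C2-lev-dict) THE κ-ORBITAL INTEGRAL OF THE LEVEL PIECE `𝟙_{K_{a,b}}` ON A TYPE-(2) `γ_H`, UNFOLDED** (law-free; ★ p856218 §1's twin with `1_{K_t} ↦ 𝟙_{K_{a,b}}`,
`#Fix ↦ cnt_{a,b}`): at a ramified non-split CM place `w ∣ v`, for a `G`-regular `γ_H` whose `w`-characteristic polynomial has no root in `L_w` and the canonical orbital family
`mG₃` of a Haar measure `νG₃`, there are matches `δ₊, δ₋` of κ-signs `+1, −1`, every match of sign `+1` (resp. `−1`) is conjugate to `δ₊` (resp. `δ₋`), and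
`Σᶠ_c Δ‴_v(γ_H, out c)·Φ(c, 𝟙_{K_{a,b}}; mG₃) = τ_v(γ_H, μ)·D_v(γ_H)·νG₃(K).toReal·(cnt_{a,b}(ι_w δ₊) − cnt_{a,b}(ι_w δ₋))` with `cnt_{a,b}` ★ p858704's token — the left side of
the X-currency identity ★ p859279 (V6) asks for, READ AS TWO LEVEL CENSUSES (★ p847309 two classes; §2 at `δ_±`, regular by ★ `isRegularElt_of_isLocalNormPair`, compact
centraliser by ★ p846839). [cite: Rogawski1990, §4.3 (4.3.1)–(4.3.2) p. 43; §4.9 Prop. 4.9.1 (b) p. 55] [cite: Kottwitz1988, §2] [cite: Flicker1998UnitaryFL, Thm. 18 p. 97] -/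
theorem finsum_delta_mul_classOrbitalIntegral_levels_eq_of_typeTwo (L : Type) [Field L] [NumberField L] [IsCMField L]
    {v : HeightOneSpectrum (𝓞 ↥(maximalRealSubfield L))} (w : UnitaryGroup.PlacesOver L v)
    (hw : IsCMField.complexConj L • w.1 = w.1) (he : v.asIdeal.ramificationIdx' w.1.asIdeal ≠ 1)
    (ϖ : (w.1.adicCompletion L)) (hϖ : Valued.v ϖ = WithZero.exp (-1 : ℤ)) (μ : HeckeCharacter L)
    [MeasurableSpace ((UnitaryGroup.cmDatum L 3 (Matrix.of fun i j : Fin 3 => if i.val + j.val + 1 = 3 then (1 : L) else 0)).Local v)] [BorelSpace ((UnitaryGroup.cmDatum L 3 (Matrix.of fun i j : Fin 3 => if i.val + j.val + 1 = 3 then (1 : L) else 0)).Local v)]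
    [∀ γ : ((UnitaryGroup.cmDatum L 3 (Matrix.of fun i j : Fin 3 => if i.val + j.val + 1 = 3 then (1 : L) else 0)).Local v), MeasurableSpace (((UnitaryGroup.cmDatum L 3 (Matrix.of fun i j : Fin 3 => if i.val + j.val + 1 = 3 then (1 : L) else 0)).Local v) ⧸ Subgroup.centralizer ({γ} : Set ((UnitaryGroup.cmDatum L 3 (Matrix.of fun i j : Fin 3 => if i.val + j.val + 1 = 3 then (1 : L) else 0)).Local v)))]
    [∀ γ : ((UnitaryGroup.cmDatum L 3 (Matrix.of fun i j : Fin 3 => if i.val + j.val + 1 = 3 then (1 : L) else 0)).Local v), BorelSpace (((UnitaryGroup.cmDatum L 3 (Matrix.of fun i j : Fin 3 => if i.val + j.val + 1 = 3 then (1 : L) else 0)).Local v) ⧸ Subgroup.centralizer ({γ} : Set ((UnitaryGroup.cmDatum L 3 (Matrix.of fun i j : Fin 3 => if i.val + j.val + 1 = 3 then (1 : L) else 0)).Local v)))]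
    (νG₃ : Measure ((UnitaryGroup.cmDatum L 3 (Matrix.of fun i j : Fin 3 => if i.val + j.val + 1 = 3 then (1 : L) else 0)).Local v)) [νG₃.IsHaarMeasure] [νG₃.IsMulRightInvariant]
    (mG₃ : OrbitalMeasureFamily ((UnitaryGroup.cmDatum L 3 (Matrix.of fun i j : Fin 3 => if i.val + j.val + 1 = 3 then (1 : L) else 0)).Local v))
    (hmG : mG₃.IsCanonical (fun γ => IsRegularElt (γ.val : GL (Fin 3) (UnitaryGroup.LocalRing L v))) νG₃) (a b : ℕ)
    {γH : ((UnitaryGroup.cmDatum L 2 (Matrix.of fun i j : Fin 2 => if i.val + j.val + 1 = 2 then (1 : L) else 0)).Local v × (UnitaryGroup.cmDatum L 1 (Matrix.of fun i j : Fin 1 => if i.val + j.val + 1 = 1 then (1 : L) else 0)).Local v)}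
    (hreg : IsLocalGRegular L v γH)
    (hirr : ¬ (∃ x : (w.1.adicCompletion L), (((((γH).1.val : GL (Fin 2) (UnitaryGroup.LocalRing L v)).val.map (Pi.evalRingHom (fun w' : UnitaryGroup.PlacesOver L v => w'.1.adicCompletion L) w))).charpoly).IsRoot x)) :
    ∃ δp δm : ((UnitaryGroup.cmDatum L 3 (Matrix.of fun i j : Fin 3 => if i.val + j.val + 1 = 3 then (1 : L) else 0)).Local v),
      IsLocalNormPair L (Matrix.of fun i j : Fin 3 => if i.val + j.val + 1 = 3 then (1 : L) else 0) v γH δp ∧ finKappaAt L v (Matrix.of fun i j : Fin 3 => if i.val + j.val + 1 = 3 then (1 : L) else 0) γH δp = 1 ∧ IsLocalNormPair L (Matrix.of fun i j : Fin 3 => if i.val + j.val + 1 = 3 then (1 : L) else 0) v γH δm ∧ finKappaAt L v (Matrix.of fun i j : Fin 3 => if i.val + j.val + 1 = 3 then (1 : L) else 0) γH δm = -1 ∧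
      (∀ δ : ((UnitaryGroup.cmDatum L 3 (Matrix.of fun i j : Fin 3 => if i.val + j.val + 1 = 3 then (1 : L) else 0)).Local v), IsLocalNormPair L (Matrix.of fun i j : Fin 3 => if i.val + j.val + 1 = 3 then (1 : L) else 0) v γH δ → finKappaAt L v (Matrix.of fun i j : Fin 3 => if i.val + j.val + 1 = 3 then (1 : L) else 0) γH δ = 1 → IsConj δp δ) ∧
      (∀ δ : ((UnitaryGroup.cmDatum L 3 (Matrix.of fun i j : Fin 3 => if i.val + j.val + 1 = 3 then (1 : L) else 0)).Local v), IsLocalNormPair L (Matrix.of fun i j : Fin 3 => if i.val + j.val + 1 = 3 then (1 : L) else 0) v γH δ → finKappaAt L v (Matrix.of fun i j : Fin 3 => if i.val + j.val + 1 = 3 then (1 : L) else 0) γH δ = -1 → IsConj δm δ) ∧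
      ∑ᶠ c : ConjClasses ((UnitaryGroup.cmDatum L 3 (Matrix.of fun i j : Fin 3 => if i.val + j.val + 1 = 3 then (1 : L) else 0)).Local v), ((finExplicitCollection L (Matrix.of fun i j : Fin 3 => if i.val + j.val + 1 = 3 then (1 : L) else 0) μ (finExplicitDelta_conj_left_all L (Matrix.of fun i j : Fin 3 => if i.val + j.val + 1 = 3 then (1 : L) else 0) μ) (finExplicitDelta_conj_right_all L (Matrix.of fun i j : Fin 3 => if i.val + j.val + 1 = 3 then (1 : L) else 0) μ)) v).Δ γH (Quotient.out c) * classOrbitalIntegral mG₃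
          (Set.indicator {u : ((UnitaryGroup.cmDatum L 3 (Matrix.of fun i j : Fin 3 => if i.val + j.val + 1 = 3 then (1 : L) else 0)).Local v) |
            u ∈ cmLocalIntegralLevel L 3 (Matrix.of fun i j : Fin 3 => if i.val + j.val + 1 = 3 then (1 : L) else 0) v ∧
            (InLevel ϖ a (wMatrix L w hw u - 1) ∧ InLevel ϖ b ((wMatrix L w hw u - 1) * (wMatrix L w hw u - 1)))} (fun _ => (1 : ℂ))) c =
        finTau L v γH μ * (finWeylRatio L v γH : ℂ) * (((νG₃ ((cmLocalIntegralLevel L 3 (Matrix.of fun i j : Fin 3 => if i.val + j.val + 1 = 3 then (1 : L) else 0) v) : Set ((UnitaryGroup.cmDatum L 3 (Matrix.of fun i j : Fin 3 => if i.val + j.val + 1 = 3 then (1 : L) else 0)).Local v))).toReal : ℂ) *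
          (({M : Submodule (Valued.integer (w.1.adicCompletion L)) (Fin 3 → w.1.adicCompletion L) |
            IsVertexLattice (galAdicCompletionMap (L := L) (IsCMField.complexConj L) hw) ϖ ((StdForm.antidiagonal 3).over (w.1.adicCompletion L)) 0 M ∧
              mapGL ((localNonsplitEquiv (IsCMField.complexConj L) (Matrix.of fun i j : Fin 3 => if i.val + j.val + 1 = 3 then (1 : L) else 0) (IsCMField.complexConj_ne_one L) w hw δp :
                ↥(unitaryGroupOfForm (galAdicCompletionMap (L := L) (IsCMField.complexConj L) hw) (placeForm (Matrix.of fun i j : Fin 3 => if i.val + j.val + 1 = 3 then (1 : L) else 0) w.1))) : GL (Fin 3) (w.1.adicCompletion L)) M = M ∧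
              (LatticeInLevel ϖ a ((((localNonsplitEquiv (IsCMField.complexConj L) (Matrix.of fun i j : Fin 3 => if i.val + j.val + 1 = 3 then (1 : L) else 0) (IsCMField.complexConj_ne_one L) w hw δp :
                ↥(unitaryGroupOfForm (galAdicCompletionMap (L := L) (IsCMField.complexConj L) hw) (placeForm (Matrix.of fun i j : Fin 3 => if i.val + j.val + 1 = 3 then (1 : L) else 0) w.1))) : GL (Fin 3) (w.1.adicCompletion L)) : Matrix (Fin 3) (Fin 3) (w.1.adicCompletion L)) - 1) M ∧
                LatticeInLevel ϖ b (((((localNonsplitEquiv (IsCMField.complexConj L) (Matrix.of fun i j : Fin 3 => if i.val + j.val + 1 = 3 then (1 : L) else 0) (IsCMField.complexConj_ne_one L) w hw δp :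
                ↥(unitaryGroupOfForm (galAdicCompletionMap (L := L) (IsCMField.complexConj L) hw) (placeForm (Matrix.of fun i j : Fin 3 => if i.val + j.val + 1 = 3 then (1 : L) else 0) w.1))) : GL (Fin 3) (w.1.adicCompletion L)) : Matrix (Fin 3) (Fin 3) (w.1.adicCompletion L)) - 1) *
                  ((((localNonsplitEquiv (IsCMField.complexConj L) (Matrix.of fun i j : Fin 3 => if i.val + j.val + 1 = 3 then (1 : L) else 0) (IsCMField.complexConj_ne_one L) w hw δp :
                ↥(unitaryGroupOfForm (galAdicCompletionMap (L := L) (IsCMField.complexConj L) hw) (placeForm (Matrix.of fun i j : Fin 3 => if i.val + j.val + 1 = 3 then (1 : L) else 0) w.1))) : GL (Fin 3) (w.1.adicCompletion L)) : Matrix (Fin 3) (Fin 3) (w.1.adicCompletion L)) - 1)) M)}.ncard : ℂ) -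
           ({M : Submodule (Valued.integer (w.1.adicCompletion L)) (Fin 3 → w.1.adicCompletion L) |
            IsVertexLattice (galAdicCompletionMap (L := L) (IsCMField.complexConj L) hw) ϖ ((StdForm.antidiagonal 3).over (w.1.adicCompletion L)) 0 M ∧
              mapGL ((localNonsplitEquiv (IsCMField.complexConj L) (Matrix.of fun i j : Fin 3 => if i.val + j.val + 1 = 3 then (1 : L) else 0) (IsCMField.complexConj_ne_one L) w hw δm :
                ↥(unitaryGroupOfForm (galAdicCompletionMap (L := L) (IsCMField.complexConj L) hw) (placeForm (Matrix.of fun i j : Fin 3 => if i.val + j.val + 1 = 3 then (1 : L) else 0) w.1))) : GL (Fin 3) (w.1.adicCompletion L)) M = M ∧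
              (LatticeInLevel ϖ a ((((localNonsplitEquiv (IsCMField.complexConj L) (Matrix.of fun i j : Fin 3 => if i.val + j.val + 1 = 3 then (1 : L) else 0) (IsCMField.complexConj_ne_one L) w hw δm :
                ↥(unitaryGroupOfForm (galAdicCompletionMap (L := L) (IsCMField.complexConj L) hw) (placeForm (Matrix.of fun i j : Fin 3 => if i.val + j.val + 1 = 3 then (1 : L) else 0) w.1))) : GL (Fin 3) (w.1.adicCompletion L)) : Matrix (Fin 3) (Fin 3) (w.1.adicCompletion L)) - 1) M ∧
                LatticeInLevel ϖ b (((((localNonsplitEquiv (IsCMField.complexConj L) (Matrix.of fun i j : Fin 3 => if i.val + j.val + 1 = 3 then (1 : L) else 0) (IsCMField.complexConj_ne_one L) w hw δm :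
                ↥(unitaryGroupOfForm (galAdicCompletionMap (L := L) (IsCMField.complexConj L) hw) (placeForm (Matrix.of fun i j : Fin 3 => if i.val + j.val + 1 = 3 then (1 : L) else 0) w.1))) : GL (Fin 3) (w.1.adicCompletion L)) : Matrix (Fin 3) (Fin 3) (w.1.adicCompletion L)) - 1) *
                  ((((localNonsplitEquiv (IsCMField.complexConj L) (Matrix.of fun i j : Fin 3 => if i.val + j.val + 1 = 3 then (1 : L) else 0) (IsCMField.complexConj_ne_one L) w hw δm :
                ↥(unitaryGroupOfForm (galAdicCompletionMap (L := L) (IsCMField.complexConj L) hw) (placeForm (Matrix.of fun i j : Fin 3 => if i.val + j.val + 1 = 3 then (1 : L) else 0) w.1))) : GL (Fin 3) (w.1.adicCompletion L)) : Matrix (Fin 3) (Fin 3) (w.1.adicCompletion L)) - 1)) M)}.ncard : ℂ))) := by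
  have hH : ((Matrix.of fun i j : Fin 3 => if i.val + j.val + 1 = 3 then (1 : L) else 0).map (cmConjRingHom L))ᵀ = (Matrix.of fun i j : Fin 3 => if i.val + j.val + 1 = 3 then (1 : L) else 0) := antidiagOne_isHermitian L 3
  have hdet : (Matrix.of fun i j : Fin 3 => if i.val + j.val + 1 = 3 then (1 : L) else 0).det ≠ 0 := (isUnit_antidiagOne_det L 3).ne_zero
  have hH'u : IsUnit (Matrix.of fun i j : Fin 3 => if i.val + j.val + 1 = 3 then (1 : L) else 0) := (Matrix.isUnit_iff_isUnit_det _).2 (isUnit_antidiagOne_det L 3)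
  -- one match exists (frame `T = 1`: `(Φ₃)_w = J₀`)
  obtain ⟨b₀, hb₀⟩ := exists_isLocalNormPair_of_formCongr L (Matrix.of fun i j : Fin 3 => if i.val + j.val + 1 = 3 then (1 : L) else 0) w hw (1 : GL (Fin 3) (w.1.adicCompletion L)) (c := (1 : w.1.adicCompletion L)) isUnit_one
    (by rw [one_smul, placeForm_antidiagThree_eq_over L w, formCongr_one_eq]) γH
  -- the two classes and their exhaustion (★ p847309)
  obtain ⟨δp, δm, hp, hκp, hm, hκm, hexp, hexm, hsum⟩ :=
    exists_signedPair_finsum_delta_mul_classOrbitalIntegral_eq_mul_sub L (Matrix.of fun i j : Fin 3 => if i.val + j.val + 1 = 3 then (1 : L) else 0) hH hdet w hw μ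
      (finExplicitDelta_conj_left_all L (Matrix.of fun i j : Fin 3 => if i.val + j.val + 1 = 3 then (1 : L) else 0) μ) (finExplicitDelta_conj_right_all L (Matrix.of fun i j : Fin 3 => if i.val + j.val + 1 = 3 then (1 : L) else 0) μ) hirr hb₀
  refine ⟨δp, δm, hp, hκp, hm, hκm, hexp, hexm, ?_⟩
  rw [hsum mG₃ (Set.indicator {u : ((UnitaryGroup.cmDatum L 3 (Matrix.of fun i j : Fin 3 => if i.val + j.val + 1 = 3 then (1 : L) else 0)).Local v) |
            u ∈ cmLocalIntegralLevel L 3 (Matrix.of fun i j : Fin 3 => if i.val + j.val + 1 = 3 then (1 : L) else 0) v ∧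
            (InLevel ϖ a (wMatrix L w hw u - 1) ∧ InLevel ϖ b ((wMatrix L w hw u - 1) * (wMatrix L w hw u - 1)))} (fun _ => (1 : ℂ)))]
  -- the census reading (§2) at `δ₊`, `δ₋`: regular (★), compact centraliser (★ p846839)
  haveI := compactSpace_centralizer_of_isLocalNormPair_of_not_exists_isRoot_nonsplit L v w hw hH'u hreg hirr δp hp
  haveI := compactSpace_centralizer_of_isLocalNormPair_of_not_exists_isRoot_nonsplit L v w hw hH'u hreg hirr δm hm
  have hregp : IsRegularElt (δp.val : GL (Fin 3) (UnitaryGroup.LocalRing L v)) := isRegularElt_of_isLocalNormPair L (Matrix.of fun i j : Fin 3 => if i.val + j.val + 1 = 3 then (1 : L) else 0) v hp hreg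
  have hregm : IsRegularElt (δm.val : GL (Fin 3) (UnitaryGroup.LocalRing L v)) := isRegularElt_of_isLocalNormPair L (Matrix.of fun i j : Fin 3 => if i.val + j.val + 1 = 3 then (1 : L) else 0) v hm hreg
  rw [classOrbitalIntegral_levels_eq_mul_ncard_of_isRegularElt L w hw he ϖ hϖ νG₃ mG₃ hmG a b δp hregp,
    classOrbitalIntegral_levels_eq_mul_ncard_of_isRegularElt L w hw he ϖ hϖ νG₃ mG₃ hmG a b δm hregm]
  ring

end Summit.HodgeConjecture.HodgeConjecture.Cruxes.H413.F0P3cDyRamLevelsTypeTwoDictionary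

end
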